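import Summits.AtomisticToContinuum.BoseEinsteinCondensation.Theses.BECStoquasticCensoring

/-!
# Birth skeleton (BC3) for the crux `CellCountTailsU` (stmt-AtomisticToContinuum-14965)

Route `BECStoquasticCensoring` (rank-4 crux, wanted by this route only); planner skeleton
`Lines/birth.lean` (planner-skel-stmt-AtomisticToContinuum-14965-0, 2026-08-17).

**The crux.** `CellCountTailsU`: for every repulsive finite-range `v` there are `K₀`, `ρ₀ > 0`
such that for every `0 < ρ < ρ₀` there are `C`, `c₁ > 0` (after `ρ`) with: eventually in `N`,
for EVERY `K₀ ≤ K ≤ log N` (cell side `ℓ = K(ρa)^{-1/2}`, box side `L = (N/ρ)^{1/3}`, `3ℓ ≤ L`),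
some `δ > 0`, every `δ`-near-minimiser `Ψ` of the Dirichlet energy, every interior cell
`Q = x₀ + [0,ℓ)³` and every `1 ≤ M ≤ √(ρℓ³)`:
`∫_{|N_Q − ρℓ³| > M√(ρℓ³)} |Ψ|² ≤ C·e^{−c₁M²}` — sub-Gaussian tails of the cell count about the
NOMINAL centre `n̄ = ρℓ³` on the window scale `√n̄`, `K`-uniformly under the logarithmic cap.

**The line (first cut, two named stubs): RECENTRE, THEN CONCENTRATE.** The refutation history of
this item (stmt-14703, refuted-misstated: the Dirichlet wall layer displaces the MEAN count
`E_Ψ N_Q` from the nominal centre `ρℓ³`; the repair capped `K ≤ log N` and put `C, c₁` after `ρ`)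
says the statement has two independent contents, which the skeleton separates:

* `stub_meanCountDrift` — DRIFT OF THE CENTRE (local density of near-minimisers at the capped
  mesoscale): the mean count `μ = E_Ψ N_Q = ∫ N_Q |Ψ|²` of every interior cell is within
  `s·√(ρℓ³)` of the nominal `ρℓ³`, with `s = s(v, ρ) ≥ 0` chosen AFTER `ρ` and uniform in
  `K₀ ≤ K ≤ log N` (GP boundary layer: wall-adjacent deficit `≈ 0.56√K e^{−7.09K}(ρa³)^{-1/4}`
  window units, bounded at fixed `ρ` but NOT uniformly as `ρ → 0` — hence `s` after `ρ`; global
  inward displacement `n̄·O(ξ/L) = o(√n̄)` under the cap). This is exactly the locus of the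
  14703 witness, now a named lemma instead of a hidden assumption.
* `stub_centredConcentration` — SUB-GAUSSIAN CONCENTRATION ABOUT THE TRUE MEAN: for
  `0 ≤ t ≤ √(ρℓ³)`, `∫_{|N_Q − μ| ≥ t√(ρℓ³)} |Ψ|² ≤ C·e^{−c₁t²}` with `C, c₁` after `ρ`, uniform in
  `K ≤ log N` (the substantive open input: no concentration beyond the variance is in print for
  `N_Q` under `Ψ₀²`; Bogoliubov heuristics `Var N_Q ≍ n̄ξ/ℓ`, void action `≍ n̄K`).

`CellCountTailsU_of : Sig.stub_meanCountDrift → Sig.stub_centredConcentration → CellCountTailsU` is proved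
below (no sorry): constants `K₀ := max`, `ρ₀ := min`, `C' := max C 0 · e^{c₁s²}`, `c₁' := c₁/4`,
`δ := min δ₁ δ₂`; for `M ≥ s` the nominal tail event is inside the centred one at `t = M − s`
(triangle inequality) and `−c₁(M−s)² ≤ c₁s² − c₁M²/4` identically; for `1 ≤ M < s` the trivial
bound at `t = 0` is absorbed by the factor `e^{c₁s²}` — which is precisely why the crux's `C` must
come after `ρ` (refuter rattack-14703, witness (ii)).

Disproof used: none on file for stmt-14965 (no `Disproof.lean` in the crux directory at
registration); the skeleton honours the two recorded witnesses against the predecessor 14703: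
(i) macroscopic cells — excluded by the cap `K ≤ Real.log N` kept verbatim in both stubs;
(ii) `ρ → 0` wall-cell deficit — `s`, `C`, `c₁` are existential AFTER `ρ`.
-/

open MeasureTheory Filter
open scoped ENNReal

namespace Summit.AtomisticToContinuum.BoseEinsteinCondensation.Cruxes.CellCountTailsU.Birth

open Summit.AtomisticToContinuum.BoseEinsteinCondensation.Theses.BECStoquasticCensoring

/-! ## Stub signatures -/

/-- Signature of `stub_meanCountDrift`: the mean cell count of a near-minimiser sits within
`s√(ρℓ³)` of the nominal centre `ρℓ³`, `s = s(v,ρ)` uniform in `K₀ ≤ K ≤ log N`, all interior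
cells, all large `N`. -/
def Sig.stub_meanCountDrift : Prop :=
  ∀ v : ℝ → ENNReal, Literature.MathematicalPhysics.QuantumManyBody.BoseGas.IsRepulsiveFiniteRange v → ∃ K₀ ρ₀ : ℝ, 0 < ρ₀ ∧ ∀ ρ : ℝ, 0 < ρ → ρ < ρ₀ → ∃ s : ℝ, 0 ≤ s ∧ ∀ᶠ N : ℕ in Filter.atTop, ∀ K : ℝ, K₀ ≤ K → K ≤ Real.log N → let a : ℝ := (Literature.MathematicalPhysics.QuantumManyBody.BoseGas.scatteringLength v).toReal; let ℓ : ℝ := K * (ρ * a) ^ (-(1 / 2 : ℝ)); let L : ℝ := Literature.MathematicalPhysics.QuantumManyBody.BoseGas.sideLength ρ N; 3 * ℓ ≤ L → ∃ δ : ENNReal, 0 < δ ∧ ∀ Ψ : Literature.MathematicalPhysics.QuantumManyBody.BoseGas.TrialState N L, Literature.MathematicalPhysics.QuantumManyBody.BoseGas.energy v Ψ ≤ Literature.MathematicalPhysics.QuantumManyBody.BoseGas.groundStateEnergy v N L + δ → ∀ x₀ : EuclideanSpace ℝ (Fin 3), (∀ k, ℓ ≤ x₀ k ∧ x₀ k +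 2 * ℓ ≤ L) → let nQ : Literature.MathematicalPhysics.QuantumManyBody.BoseGas.Config N → ℝ := fun X => ∑ j : Fin N, ({x : EuclideanSpace ℝ (Fin 3) | ∀ k, x k ∈ Set.Ico (x₀ k) (x₀ k + ℓ)}).indicator (fun _ => (1 : ℝ)) (X j); |(∫⁻ X, ENNReal.ofReal (nQ X) * (‖Ψ.ψ X‖₊ : ENNReal) ^ 2).toReal - ρ * ℓ ^ 3| ≤ s * Real.sqrt (ρ * ℓ ^ 3)

/-- Signature of `stub_centredConcentration`: sub-Gaussian concentration of the cell count about
its OWN mean `μ = ∫ N_Q |Ψ|²` on the window scale, `0 ≤ t ≤ √(ρℓ³)`, constants after `ρ`,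
uniform in `K₀ ≤ K ≤ log N`. -/
def Sig.stub_centredConcentration : Prop :=
  ∀ v : ℝ → ENNReal, Literature.MathematicalPhysics.QuantumManyBody.BoseGas.IsRepulsiveFiniteRange v → ∃ K₀ ρ₀ : ℝ, 0 < ρ₀ ∧ ∀ ρ : ℝ, 0 < ρ → ρ < ρ₀ → ∃ C c₁ : ℝ, 0 < c₁ ∧ ∀ᶠ N : ℕ in Filter.atTop, ∀ K : ℝ, K₀ ≤ K → K ≤ Real.log N → let a : ℝ := (Literature.MathematicalPhysics.QuantumManyBody.BoseGas.scatteringLength v).toReal; let ℓ : ℝ := K * (ρ * a) ^ (-(1 / 2 : ℝ)); let L : ℝ := Literature.MathematicalPhysics.QuantumManyBody.BoseGas.sideLength ρ N; 3 * ℓ ≤ L → ∃ δ : ENNReal, 0 < δ ∧ ∀ Ψ : Literature.MathematicalPhysics.QuantumManyBody.BoseGas.TrialState N L, Literature.MathematicalPhysics.QuantumManyBody.BoseGas.energy v Ψ ≤ Literature.MathematicalPhysics.QuantumManyBody.BoseGas.groundStateEnergy v N L + δ → ∀ x₀ : EuclideanSpace ℝ (Fin 3), (∀ k, ℓ ≤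 x₀ k ∧ x₀ k + 2 * ℓ ≤ L) → ∀ t : ℝ, 0 ≤ t → t ^ 2 ≤ ρ * ℓ ^ 3 → let nQ : Literature.MathematicalPhysics.QuantumManyBody.BoseGas.Config N → ℝ := fun X => ∑ j : Fin N, ({x : EuclideanSpace ℝ (Fin 3) | ∀ k, x k ∈ Set.Ico (x₀ k) (x₀ k + ℓ)}).indicator (fun _ => (1 : ℝ)) (X j); let μ : ℝ := (∫⁻ X, ENNReal.ofReal (nQ X) * (‖Ψ.ψ X‖₊ : ENNReal) ^ 2).toReal; ∫⁻ X in {X : Literature.MathematicalPhysics.QuantumManyBody.BoseGas.Config N | t * Real.sqrt (ρ * ℓ ^ 3) ≤ |nQ X - μ|}, (‖Ψ.ψ X‖₊ : ENNReal) ^ 2 ≤ ENNReal.ofReal (C * Real.exp (-(c₁ * t ^ 2)))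

/-! ## Stubs -/

/-- stub 1 — DRIFT OF THE CENTRE (mesoscale local density of Dirichlet near-minimisers under the
logarithmic cap; GP boundary layer + global inward displacement; `s` after `ρ`). -/
theorem stub_meanCountDrift : Sig.stub_meanCountDrift := by
  sorry

/-- stub 2 — SUB-GAUSSIAN CONCENTRATION ABOUT THE TRUE MEAN (the substantive input: concentration
of `N_Q` under `|Ψ|²` beyond the variance, `K`-uniform, down to voids). -/
theorem stub_centredConcentration : Sig.stub_centredConcentration := by
  sorry

/-! ## The glue: an abstract recentring lemma, then the composition -/

/-- Recentring a centred sub-Gaussian tail bound: if `|μ − n̄| ≤ sσ` and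
`∫_{tσ ≤ |g − μ|} f ≤ C e^{−c₁t²}` for `0 ≤ t`, `t² ≤ σ²'` then for `1 ≤ M`, `M² ≤ σ²'`
`∫_{Mσ < |g − n̄|} f ≤ max C 0 · e^{c₁ s²} · e^{−(c₁/4) M²}`. -/
theorem recentre {α : Type*} [MeasurableSpace α] (ν : Measure α) (f : α → ℝ≥0∞) (g : α → ℝ)
    {nbar μ s σ v C c₁ M : ℝ} (hs : 0 ≤ s) (hc₁ : 0 < c₁)
    (hdrift : |μ - nbar| ≤ s * σ)
    (hconc : ∀ t : ℝ, 0 ≤ t → t ^ 2 ≤ v →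
      ∫⁻ x in {x | t * σ ≤ |g x - μ|}, f x ∂ν ≤ ENNReal.ofReal (C * Real.exp (-(c₁ * t ^ 2))))
    (hM : 1 ≤ M) (hMv : M ^ 2 ≤ v) :
    ∫⁻ x in {x | M * σ < |g x - nbar|}, f x ∂ν
      ≤ ENNReal.ofReal (max C 0 * Real.exp (c₁ * s ^ 2) * Real.exp (-(c₁ / 4 * M ^ 2))) := by
  rcases le_or_gt s M with hsM | hsM
  · -- recentre at t = M - s ≥ 0
    have ht0 : 0 ≤ M - s := sub_nonneg.mpr hsM
    have htv : (M - s) ^ 2 ≤ v := by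
      nlinarith [mul_nonneg hs (show (0 : ℝ) ≤ 2 * M - s by linarith)]
    have hsub : {x | M * σ < |g x - nbar|} ⊆ {x | (M - s) * σ ≤ |g x - μ|} := by
      intro x hx
      simp only [Set.mem_setOf_eq] at hx ⊢
      have h1 : |g x - nbar| ≤ |g x - μ| + |μ - nbar| := abs_sub_le (g x) μ nbar
      have h2 : (M - s) * σ = M * σ - s * σ := by ring
      rw [h2]
      linarith
    calc ∫⁻ x in {x | M * σ < |g x - nbar|}, f x ∂ν
        ≤ ∫⁻ x in {x | (M - s) * σ ≤ |g x - μ|}, f x ∂ν := lintegral_mono_set hsub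
      _ ≤ ENNReal.ofReal (C * Real.exp (-(c₁ * (M - s) ^ 2))) := hconc _ ht0 htv
      _ ≤ ENNReal.ofReal (max C 0 * Real.exp (c₁ * s ^ 2) * Real.exp (-(c₁ / 4 * M ^ 2))) := by
        apply ENNReal.ofReal_le_ofReal
        have hexp : Real.exp (-(c₁ * (M - s) ^ 2))
            ≤ Real.exp (c₁ * s ^ 2) * Real.exp (-(c₁ / 4 * M ^ 2)) := by
          rw [← Real.exp_add]
          apply Real.exp_le_exp.mpr
          nlinarith [mul_nonneg hc₁.le (sq_nonneg (M - 4 / 3 * s)), mul_nonneg hc₁.le (sq_nonneg s)]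
        calc C * Real.exp (-(c₁ * (M - s) ^ 2))
            ≤ max C 0 * Real.exp (-(c₁ * (M - s) ^ 2)) :=
              mul_le_mul_of_nonneg_right (le_max_left _ _) (Real.exp_pos _).le
          _ ≤ max C 0 * (Real.exp (c₁ * s ^ 2) * Real.exp (-(c₁ / 4 * M ^ 2))) :=
              mul_le_mul_of_nonneg_left hexp (le_max_right _ _)
          _ = _ := by ring
  · -- 1 ≤ M < s: trivial bound at t = 0, absorbed by e^{c₁ s²}
    have h0v : (0 : ℝ) ^ 2 ≤ v := by nlinarith [sq_nonneg M]
    have hM2s : M ^ 2 ≤ s ^ 2 := by nlinarith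
    have hsub : {x | M * σ < |g x - nbar|} ⊆ {x | 0 * σ ≤ |g x - μ|} := by
      intro x _
      simp only [Set.mem_setOf_eq, zero_mul]
      exact abs_nonneg _
    calc ∫⁻ x in {x | M * σ < |g x - nbar|}, f x ∂ν
        ≤ ∫⁻ x in {x | 0 * σ ≤ |g x - μ|}, f x ∂ν := lintegral_mono_set hsub
      _ ≤ ENNReal.ofReal (C * Real.exp (-(c₁ * 0 ^ 2))) := hconc 0 le_rfl h0v
      _ ≤ ENNReal.ofReal (max C 0 * Real.exp (c₁ * s ^ 2) * Real.exp (-(c₁ / 4 * M ^ 2))) := by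
        apply ENNReal.ofReal_le_ofReal
        have hexp : Real.exp (-(c₁ * 0 ^ 2))
            ≤ Real.exp (c₁ * s ^ 2) * Real.exp (-(c₁ / 4 * M ^ 2)) := by
          rw [← Real.exp_add]
          apply Real.exp_le_exp.mpr
          nlinarith [mul_nonneg hc₁.le (sub_nonneg.mpr hM2s), mul_nonneg hc₁.le (sq_nonneg M)]
        calc C * Real.exp (-(c₁ * 0 ^ 2))
            ≤ max C 0 * Real.exp (-(c₁ * 0 ^ 2)) :=
              mul_le_mul_of_nonneg_right (le_max_left _ _) (Real.exp_pos _).le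
          _ ≤ max C 0 * (Real.exp (c₁ * s ^ 2) * Real.exp (-(c₁ / 4 * M ^ 2))) :=
              mul_le_mul_of_nonneg_left hexp (le_max_right _ _)
          _ = _ := by ring

/-- **Composition (kernel-checked, no sorry).** The two stubs imply the crux BY NAME. -/
theorem CellCountTailsU_of : Sig.stub_meanCountDrift → Sig.stub_centredConcentration → CellCountTailsU := by
  intro hD hC v hv
  obtain ⟨K₁, ρ₁, hρ₁, hD⟩ := hD v hv
  obtain ⟨K₂, ρ₂, hρ₂, hC⟩ := hC v hv
  refine ⟨max K₁ K₂, min ρ₁ ρ₂, lt_min hρ₁ hρ₂, ?_⟩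
  intro ρ hρ hρlt
  obtain ⟨s, hs, hD⟩ := hD ρ hρ (lt_of_lt_of_le hρlt (min_le_left _ _))
  obtain ⟨C, c₁, hc₁, hC⟩ := hC ρ hρ (lt_of_lt_of_le hρlt (min_le_right _ _))
  refine ⟨max C 0 * Real.exp (c₁ * s ^ 2), c₁ / 4, by positivity, ?_⟩
  filter_upwards [hD, hC] with N hDN hCN
  intro K hK hKlog a ℓ L h3ℓ
  obtain ⟨δ₁, hδ₁, hD⟩ := hDN K (le_trans (le_max_left _ _) hK) hKlog h3ℓ
  obtain ⟨δ₂, hδ₂, hC⟩ := hCN K (le_trans (le_max_right _ _) hK) hKlog h3ℓ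
  refine ⟨min δ₁ δ₂, lt_min hδ₁ hδ₂, ?_⟩
  intro Ψ hΨ x₀ hx₀ M hM1 hM2
  have hΨ₁ := hD Ψ (hΨ.trans (add_le_add le_rfl (min_le_left _ _))) x₀ hx₀
  have hΨ₂ := hC Ψ (hΨ.trans (add_le_add le_rfl (min_le_right _ _))) x₀ hx₀
  have key := recentre (volume : Measure (Literature.MathematicalPhysics.QuantumManyBody.BoseGas.Config N))
    (fun X => (‖Ψ.ψ X‖₊ : ENNReal) ^ 2)
    (fun X => ∑ j : Fin N, ({x : EuclideanSpace ℝ (Fin 3) | ∀ k, x k ∈ Set.Ico (x₀ k) (x₀ k + ℓ)}).indicator (fun _ => (1 : ℝ)) (X j))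
    hs hc₁ hΨ₁ hΨ₂ hM1 hM2
  exact key

end Summit.AtomisticToContinuum.BoseEinsteinCondensation.Cruxes.CellCountTailsU.Birth
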